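import Literature.AlgebraicGeometry.AbelianSchemes.RoofBaseChangeAlongBaseIso     -- ★ p849519 (LA4-p01 (g2)) §1 TRANSFERS OF POINTS (`pointsTransfer_ext`, `pointsTransfer_left_comp_snd`)
import Literature.AlgebraicGeometry.AbelianSchemes.AbelianSchemeBaseChangeComp      -- ★ `baseChangeCompGrpIso` and its projection lemmas
import HarnessLib

/-!
# The TRANSFER of the fibre point of a section, re-read through `(𝒜 ×_Y Spec Ω) ×_Ω Spec Ω′ ≅ 𝒜 ×_Y Spec Ω′`, IS the fibre point at the composite

Topic `AlgebraicGeometry/AbelianSchemes`; namespace `Literature.AlgebraicGeometry.AbelianSchemes.AbelianSchemeOver`.  THEOREMS ONLY (no definition,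
no named fact, no instance, no notation, no `sorry`).  Cell `hodgecm-mathlib` (D-0151), P6 «MOD programme» (crux hLiu418 = stmt-HodgeConjecture-24832,
`--supports`, count-neutral), line «L4», X-LEAF `Lines/F0_P6a_EExports.lean` (A-p01 (g28)) socket `stub_ECtoΩ` (LA4-plan (g0) DEAL #20′ (ii)): the
`hpt`∕`hpt′` JUNCTION of the re-index step.  After ★ `roof_baseChange_of_isIso` (LA4-p01 (g2)) ∕ ★ `coverKer_baseChange_of_transfer` (LA4-p03 (g2)) have moved a
roof ∕ cover of the E-tuple's fibres from `Spec Ω` to the base changes `(𝒜 ×_Y Spec Ω) ×_Ω Spec Ω′` with level points the TRANSFERS `ε(σᵃ(ℓ))`, the shape is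
re-read on `𝒜 ×_Y Spec Ω′` along the comparison isomorphism (★ `baseChangeCompGrpIso`, six clauses ★ `tupleRel_baseChangeCompGrpIso_inv∕_hom`, the exact
group isomorphism ★ `exists_iso_of_tupleRel_id`) by ★ `roof_transport_along_iso` ∕ ★ `coverKer_transport_along_iso`, whose point hypothesis `hpt` is exactly
THIS FILE: the transferred point `ε(σᵃ(ℓ))`, mapped by (any `Over`-morphism with the underlying scheme map of) the comparison isomorphism, is the level
point `σᵃ(x ≫ ℓ)` of the E-reading at the moved point — in ★ `restrictPt` currency (the E-readings' `lvlPtEOf … = 𝒜.restrictPt ℓ (lvl.section_ a)`).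
HC_CM is proved only modulo the 2 remaining named inputs (hLiu418 24832, h413 24833) until rung 0 closes; nothing here is about HC.

THE MATHEMATICS ([GortzWedhorn2020] (4.7), Prop. 4.16: `(X ×_S S′) ×_{S′} T ≅ X ×_S T` compatibly with the projections; [MumfordFogartyKirwan1994] Ch. 7 §2
Def. 7.1–7.2: the points `σᵢ(s)` of the fibres and their pull-backs).  For `𝒜 → Y`, `ℓ : Spec Ω → Y`, `x : Spec Ω′ → Spec Ω`, a section `σ` of `𝒜 → Y` and a
transfer of points `ε` along `x` for `𝒜 ×_Y Spec Ω` (`pr ∘ ε(P) = x ≫ P`): both `φ⁻¹(ε(σ(ℓ)))` and `σ(x ≫ ℓ)` are the `Ω′`-point `((x ≫ ℓ) ≫ σ, 𝟙)` of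
`𝒜 ×_Y Spec Ω′` — checked on the two projections (★ `baseChangeCompGrpIso_inv_left_fst∕_snd`, ★ `restrictPt_left_fst∕_snd`); the `φ`-direction by the
uniqueness of transfers (★ `pointsTransfer_ext`) and ★ `baseChangeCompGrpIso_hom_left_fst_fst∕_hom_left_snd`.

* `map_pointsTransfer_restrictPt_of_left_eq_baseChangeCompGrpIso_inv` — `f(ε(σ(ℓ))) = σ(x ≫ ℓ)` for every `f` over `(𝒜.baseChangeCompGrpIso ℓ x).inv`;
* `map_restrictPt_comp_of_left_eq_baseChangeCompGrpIso_hom` — `f′(σ(x ≫ ℓ)) = ε(σ(ℓ))` for every `f′` over `(𝒜.baseChangeCompGrpIso ℓ x).hom`.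

## References
* [GortzWedhorn2020] U. Görtz, T. Wedhorn, *Algebraic Geometry I*, 2nd ed. (2020), Section (4.7) (pp. 107–108), Prop. 4.16 (p. 101).
* [MumfordFogartyKirwan1994] D. Mumford, J. Fogarty, F. Kirwan, *Geometric Invariant Theory*, 3rd ed. (1994), Ch. 7 §2 Def. 7.1 and Def. 7.2 (p. 129).
-/

set_option autoImplicit false

noncomputable section

-- Mathlib's `Over`/pull-back API is stated across semireducible wrappers (as in the ★ `AbelianSchemes/*` files).
set_option backward.isDefEq.respectTransparency false

universe u

open CategoryTheory CategoryTheory.Limits AlgebraicGeometry MonoidalCategory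
open scoped MonObj

namespace Literature.AlgebraicGeometry.AbelianSchemes

namespace AbelianSchemeOver

open Literature.AlgebraicGeometry.Motives (AlgPoints specOver)

section ReIndex

variable {Y : Scheme.{u}} (𝒜 : AbelianSchemeOver Y) {Ω Ω' : Type u} [Field Ω] [Field Ω']
  (ℓ : Spec (.of Ω) ⟶ Y) (x : Spec (.of Ω') ⟶ Spec (.of Ω))
  {ε : (𝒜.baseChange ℓ).toAffine.toAbelianVariety.Points Ω → ((𝒜.baseChange ℓ).baseChange x).toAffine.toAbelianVariety.Points Ω'}
  (hε : ∀ P, (ε P).left ≫ pullback.fst (𝒜.baseChange ℓ).X.hom x = x ≫ P.left)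

include hε in
/-- **`φ⁻¹(ε(σ(ℓ))) = σ(x ≫ ℓ)`**: the transfer along `x` of the fibre point `σ(ℓ) ∈ 𝒜_ℓ(Ω)` of a section `σ`, mapped by any `Over`-morphism `f` whose underlying
scheme map is that of `(𝒜.baseChangeCompGrpIso ℓ x)⁻¹ : (𝒜 ×_Y Spec Ω) ×_Ω Spec Ω′ → 𝒜 ×_Y Spec Ω′` (e.g. the exact group isomorphism of ★ `exists_iso_of_tupleRel_id`
on ★ `tupleRel_baseChangeCompGrpIso_inv`), is the fibre point `σ(x ≫ ℓ) ∈ 𝒜_{x ≫ ℓ}(Ω′)` — the `hpt` hypothesis of ★ `roof_transport_along_iso` ∕ ★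
`coverKer_transport_along_iso` for the re-index step of `stub_ECtoΩ`. [cite: GortzWedhorn2020, Section (4.7) (pp. 107–108) and Prop. 4.16 (p. 101)]
[cite: MumfordFogartyKirwan1994, Ch. 7 §2 Definition 7.1 and Definition 7.2 (p. 129)] -/
theorem map_pointsTransfer_restrictPt_of_left_eq_baseChangeCompGrpIso_inv
    (f : ((𝒜.baseChange ℓ).baseChange x).X ⟶ (𝒜.baseChange (x ≫ ℓ)).X) (hf : f.left = (𝒜.baseChangeCompGrpIso ℓ x).inv.hom.hom.left)
    (σ : 𝒜.Sections) :
    (AlgPoints.map f (ε (𝒜.restrictPt ℓ σ)) : (𝒜.baseChange (x ≫ ℓ)).toAffine.toAbelianVariety.Points Ω') = 𝒜.restrictPt (x ≫ ℓ) σ := by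
  apply Over.OverMorphism.ext
  rw [AlgPoints.map_apply, Over.comp_left, hf]
  apply pullback.hom_ext
  · rw [Category.assoc, baseChangeCompGrpIso_inv_left_fst, ← Category.assoc]
    erw [hε (𝒜.restrictPt ℓ σ)]
    rw [Category.assoc, restrictPt_left_fst, restrictPt_left_fst, Category.assoc]
  · rw [Category.assoc, baseChangeCompGrpIso_inv_left_snd, restrictPt_left_snd]
    exact pointsTransfer_left_comp_snd (ε (𝒜.restrictPt ℓ σ))

include hε in
/-- **`φ(σ(x ≫ ℓ)) = ε(σ(ℓ))`** — the opposite direction: any `Over`-morphism `f′` over `(𝒜.baseChangeCompGrpIso ℓ x).hom : 𝒜 ×_Y Spec Ω′ → (𝒜 ×_Y Spec Ω) ×_Ω Spec Ω′`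
carries the fibre point `σ(x ≫ ℓ)` to the transfer of `σ(ℓ)` (uniqueness of transfers ★ `pointsTransfer_ext`: its projection to `𝒜 ×_Y Spec Ω` is `x ≫ σ(ℓ)`).
[cite: GortzWedhorn2020, Section (4.7) (pp. 107–108) and Prop. 4.16 (p. 101)] [cite: MumfordFogartyKirwan1994, Ch. 7 §2 Definition 7.1 and Definition 7.2 (p. 129)] -/
theorem map_restrictPt_comp_of_left_eq_baseChangeCompGrpIso_hom
    (f' : (𝒜.baseChange (x ≫ ℓ)).X ⟶ ((𝒜.baseChange ℓ).baseChange x).X) (hf' : f'.left = (𝒜.baseChangeCompGrpIso ℓ x).hom.hom.hom.left)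
    (σ : 𝒜.Sections) :
    (AlgPoints.map f' (𝒜.restrictPt (x ≫ ℓ) σ) : ((𝒜.baseChange ℓ).baseChange x).toAffine.toAbelianVariety.Points Ω') = ε (𝒜.restrictPt ℓ σ) := by
  refine pointsTransfer_ext hε (𝒜.restrictPt ℓ σ) _ ?_
  rw [AlgPoints.map_apply, Over.comp_left, hf']
  -- the projection lemmas of ★ `baseChangeCompGrpIso`, re-read with `(𝒜 ×_Y ℓ).hom = pr₂`
  have h1 : (𝒜.baseChangeCompGrpIso ℓ x).hom.hom.hom.left ≫ pullback.fst (𝒜.baseChange ℓ).X.hom x ≫ pullback.fst 𝒜.X.hom ℓ =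
      pullback.fst 𝒜.X.hom (x ≫ ℓ) :=
    baseChangeCompGrpIso_hom_left_fst_fst 𝒜 ℓ x
  have h2 : (𝒜.baseChangeCompGrpIso ℓ x).hom.hom.hom.left ≫ pullback.snd (𝒜.baseChange ℓ).X.hom x = pullback.snd 𝒜.X.hom (x ≫ ℓ) :=
    baseChangeCompGrpIso_hom_left_snd 𝒜 ℓ x
  have hsq : pullback.fst (𝒜.baseChange ℓ).X.hom x ≫ pullback.snd 𝒜.X.hom ℓ = pullback.snd (𝒜.baseChange ℓ).X.hom x ≫ x :=
    pullback.condition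
  have h3 : (𝒜.restrictPt (x ≫ ℓ) σ).left ≫ pullback.snd 𝒜.X.hom (x ≫ ℓ) = 𝟙 _ := 𝒜.restrictPt_left_snd (x ≫ ℓ) σ
  apply pullback.hom_ext
  · -- first projections to `𝒜`: both are `(x ≫ ℓ) ≫ σ`
    have h4 : (𝒜.restrictPt ℓ σ).left ≫ pullback.fst 𝒜.X.hom ℓ = ℓ ≫ σ.left := 𝒜.restrictPt_left_fst ℓ σ
    simp only [Category.assoc]
    rw [h1, h4]
    exact (𝒜.restrictPt_left_fst (x ≫ ℓ) σ).trans (Category.assoc _ _ _)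
  · -- second projections to `Spec Ω`: both are `x`
    have h5 : (𝒜.restrictPt ℓ σ).left ≫ pullback.snd 𝒜.X.hom ℓ = 𝟙 _ := 𝒜.restrictPt_left_snd ℓ σ
    simp only [Category.assoc]
    rw [hsq, reassoc_of% h2, reassoc_of% h3, h5]
    exact (Category.comp_id x).symm

end ReIndex

end AbelianSchemeOver

end Literature.AlgebraicGeometry.AbelianSchemes

end
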